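import Summits.QuantumFields.YangMills.Theorems.UnitScaleTiltProp7SectET3ObjectsPd
import HarnessLib

/-!
# Route `UnitScaleTilt`, crux K1 child «MinimiserStabilityRegPr» (stmt-QuantumFields-19200), skeleton v10, stub `stub_existenceMinimalOrbit` (EX), route (α) — **THE SOLUTION OF (111)
# LIES IN EVERY CLOSED REAL SUBSPACE THE LETTERS PRESERVE** (split (R) of the XL row, knit ruler's LOCATE (R) 2026-08-28 ≈09:55Z; ★★OWNER ACK 42 «consume by name — GO»): at the
# T³ objects of ✓`Prop7SectET3ObjectsPd.prop6_T3`, if `𝔊(U₀)` maps a set `T` of real data into a closed real subspace `S` of the space (115), the current `J(U₀) ∈ T`, and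
# `(δ∕δA′)V` maps `S + 𝔄` (on the ball) into `T`, then EVERY solution `A₁` of (111) in the open (115)-ball `ε₄` lies in `S` — by lit-balaban's ✓`B11Prop6Scheme.solution_mem_of_invariant`
# («used … for reality of the solution») for the contraction (116) and the UNIQUENESS clause of ✓`exists_solution_concrete`.  This is the tool by which «`A₁` is `𝔤`-valued» becomes
# three displayed reality rows about the opaque letters `𝔊(U₀)`, `(δ∕δA′)V`, `J(U₀)` (N06 ∕ P4 class) instead of XL content

Cell `ym3-torus`, width seat `ym-ust-19200-w2` (gen 3; EX KNIT RULER).  THEOREMS ONLY (0 `def`, 0 `sorry`).  Fixed-point plumbing: nothing here closes the stub; `--supports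
stmt-QuantumFields-19200 --as helper`, count-neutral.  YM₃ on T³ is a ladder rung (R3), not the Clay problem; nothing here claims the stub, the crux, d = 4 or the mass gap.

THE PRINT.  [Balaban1985Variational] p. 295: «A solution of Eq. (111) is a fixed point of the transformation A₁ → −𝔊J − 𝔊((δ∕δA′)V)(A₁ + H₁B) (116) … Eq. (111) has exactly one
solution in the space (115)»; p. 286 (51): «for A′ with values in 𝔤 the configuration D(A′) has values in 𝔤 also» — the same uniqueness mechanism one storey up: real letters on
real data have a real fixed point, and the fixed point is unique.

WHAT IS PROVED (sorry-free, no definition).  ★★ **`solution_mem_of_invariant_T3`** — binders of ✓`prop6_T3` verbatim (`h𝒢`, `hW`, constants, `3L ≤ B₃`, `2B₀C₁B₃ε₁ ≤ ε₄`, `4ε₄ ≤ a₃`,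
`16B₀C₄ε₄ ≤ 1`, `RegPr F n K (C₁B₃ε₁) U₀`, `‖𝔄‖ < 2·3L·B₀C₁ε₁`) plus a closed `ℝ`-submodule `S` of (115)_{U₀} and a set `T` of (−3)-data with `𝔊(T) ⊆ S`, `J(U₀) ∈ T`,
`X ∈ S, ‖X‖ ≤ ε₄ ⇒ W(X + 𝔄) ∈ T` ⟹ every `A₁` with `‖A₁‖ < ε₄` solving (111) lies in `S`.  HONEST SCOPE: plumbing; the reality of the letters is displayed by the consumer.

References: T. Bałaban, CMP 102 (1985) 277–309 [Balaban1985Variational] ((51) p.286, (111) p.294, (115)–(121) p.295, Prop. 6 p.295).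
-/

set_option autoImplicit false

noncomputable section

open Metric Set
open scoped Matrix.Norms.L2Operator

namespace Summit.QuantumFields.YangMills.Theorems.Prop7Prop6RealSolution

open Literature.MathematicalPhysics.QuantumFieldTheory.Balaban1983to89
open T3ContinuumYM3Torus T3PrintedRegularMinimiser
open B4Sect5Torus (TSite)
open B9SectCLatticeCarrier (Bond)
open B10Eq27TorusAxialLog (unitsField toUField)
open B11Eq115Space (NegSize Space115)
open B11Eq111FrakG (nabla115)
open B11Eq98CurrentSlot (Jcur norm_Jcur_le)
open B13Contraction113 (QuadAnalytic)
open B11Prop6Scheme (mapT mapT_apply solution_mem_of_invariant)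
open B11Prop6Model (eq111_iff_fixed)
open B11Eq174Chart (Regime)
open B11Prop6Concrete (exists_solution_concrete)
open Summit.QuantumFields.YangMills.Theorems.Prop7SectET3Objects (three_L_cast)
open Summit.QuantumFields.YangMills.Theorems.Prop7SectET3ObjectsPd (isUnitaryBg_T3 inU2cur_of_regPr)

variable {F : T3Family} {n K : ℕ} {Pd : Fin (F.P K).d → ℕ} (e : Site (F.P K) 0 ≃ TSite (F.P K).d Pd)
  (he : ∀ (x : Site (F.P K) 0) (μ : Fin (F.P K).d), e (x.shift μ) = B9Eq33CovDerivVector.shiftEquiv μ (e x))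

include he in
/-- ★★ **EVERY SOLUTION OF (111) IN THE BALL LIES IN EVERY CLOSED REAL SUBSPACE THE LETTERS PRESERVE** (Prop. 6's uniqueness + the contraction (116) run inside `S`): with the
binders of ✓`prop6_T3`, a closed `ℝ`-submodule `S` of the space (115), a set `T` of (−3)-data, `𝔊(T) ⊆ S`, `J(U₀) ∈ T`, and `W(X + 𝔄) ∈ T` for `X ∈ S`, `‖X‖ ≤ ε₄`: every `A₁` with
`‖A₁‖ < ε₄` and `A₁ + 𝔊J(U₀) + 𝔊(W(A₁ + 𝔄)) = 0` belongs to `S`. [cite: Balaban1985Variational, Prop. 6 p.295, (116) p.295, (51) p.286] -/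
theorem solution_mem_of_invariant_T3 [Fact (0 < (F.L : ℝ))] [Fact (0 < ((F.L : ℝ)⁻¹) ^ (K - n))] {B₀ C₄ a₃ C₁ B₃ ε₁ ε₄ : ℝ}
    (U₀ : GaugeField (F.P K) 0 (Matrix.specialUnitaryGroup (Fin 2) ℂ))
    {𝒢 : NegSize (F.L : ℝ) (((F.L : ℝ)⁻¹) ^ (K - n)) (fun _ : Bond (F.P K).d Pd => K - n) 3
            (Matrix (Fin 2) (Fin 2) ℂ) →L[ℂ]
          Space115 (F.L : ℝ) (((F.L : ℝ)⁻¹) ^ (K - n)) (fun _ : Bond (F.P K).d Pd => K - n)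
            (fun _ : Bond (F.P K).d Pd × Fin (F.P K).d => K - n)
            (nabla115 (((F.L : ℝ)⁻¹) ^ (K - n))
              (fun b : Bond (F.P K).d Pd => unitsField (toUField U₀) ⟨e.symm b.1, b.2⟩))}
    {W : Space115 (F.L : ℝ) (((F.L : ℝ)⁻¹) ^ (K - n)) (fun _ : Bond (F.P K).d Pd => K - n)
            (fun _ : Bond (F.P K).d Pd × Fin (F.P K).d => K - n)
            (nabla115 (((F.L : ℝ)⁻¹) ^ (K - n))
              (fun b : Bond (F.P K).d Pd => unitsField (toUField U₀) ⟨e.symm b.1, b.2⟩)) →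
          NegSize (F.L : ℝ) (((F.L : ℝ)⁻¹) ^ (K - n)) (fun _ : Bond (F.P K).d Pd => K - n) 3
            (Matrix (Fin 2) (Fin 2) ℂ)}
    (h𝒢 : ∀ f, ‖𝒢 f‖ ≤ B₀ * ‖f‖) (hW : QuadAnalytic W C₄ a₃) (hB₀ : 0 < B₀) (hC₄ : 0 < C₄) (hC₁ : 0 < C₁) (hB₃ : 0 < B₃) (hε₁ : 0 < ε₁)
    (hdLB₃ : (3 : ℝ) * F.L ≤ B₃) (h1 : 2 * B₀ * C₁ * B₃ * ε₁ ≤ ε₄) (h2 : 4 * ε₄ ≤ a₃) (h3 : 16 * B₀ * C₄ * ε₄ ≤ 1)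
    (hreg : RegPr F n K (C₁ * B₃ * ε₁) U₀)
    {𝔄 : Space115 (F.L : ℝ) (((F.L : ℝ)⁻¹) ^ (K - n)) (fun _ : Bond (F.P K).d Pd => K - n)
            (fun _ : Bond (F.P K).d Pd × Fin (F.P K).d => K - n)
            (nabla115 (((F.L : ℝ)⁻¹) ^ (K - n))
              (fun b : Bond (F.P K).d Pd => unitsField (toUField U₀) ⟨e.symm b.1, b.2⟩))}
    (h𝔄 : ‖𝔄‖ < 2 * ((3 : ℝ) * F.L) * B₀ * C₁ * ε₁)
    -- the closed real subspace of (115)-fields and the real data, preserved by the letters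
    (S : Submodule ℝ (Space115 (F.L : ℝ) (((F.L : ℝ)⁻¹) ^ (K - n)) (fun _ : Bond (F.P K).d Pd => K - n)
            (fun _ : Bond (F.P K).d Pd × Fin (F.P K).d => K - n)
            (nabla115 (((F.L : ℝ)⁻¹) ^ (K - n))
              (fun b : Bond (F.P K).d Pd => unitsField (toUField U₀) ⟨e.symm b.1, b.2⟩))))
    (hS : IsClosed (S : Set (Space115 (F.L : ℝ) (((F.L : ℝ)⁻¹) ^ (K - n)) (fun _ : Bond (F.P K).d Pd => K - n)
            (fun _ : Bond (F.P K).d Pd × Fin (F.P K).d => K - n)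
            (nabla115 (((F.L : ℝ)⁻¹) ^ (K - n))
              (fun b : Bond (F.P K).d Pd => unitsField (toUField U₀) ⟨e.symm b.1, b.2⟩)))))
    (T : Set (NegSize (F.L : ℝ) (((F.L : ℝ)⁻¹) ^ (K - n)) (fun _ : Bond (F.P K).d Pd => K - n) 3 (Matrix (Fin 2) (Fin 2) ℂ)))
    (h𝒢T : ∀ f ∈ T, 𝒢 f ∈ S)
    (hJT : Jcur (fun b : Bond (F.P K).d Pd => unitsField (toUField U₀) ⟨e.symm b.1, b.2⟩) ∈ T)
    (hWT : ∀ X ∈ S, ‖X‖ ≤ ε₄ → W (X + 𝔄) ∈ T) :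
    ∀ A₁ : Space115 (F.L : ℝ) (((F.L : ℝ)⁻¹) ^ (K - n)) (fun _ : Bond (F.P K).d Pd => K - n)
            (fun _ : Bond (F.P K).d Pd × Fin (F.P K).d => K - n)
            (nabla115 (((F.L : ℝ)⁻¹) ^ (K - n))
              (fun b : Bond (F.P K).d Pd => unitsField (toUField U₀) ⟨e.symm b.1, b.2⟩)),
      ‖A₁‖ < ε₄ →
      A₁ + 𝒢 (Jcur fun b : Bond (F.P K).d Pd => unitsField (toUField U₀) ⟨e.symm b.1, b.2⟩) + 𝒢 (W (A₁ + 𝔄)) = 0 →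
      A₁ ∈ S := by
  intro A₁ hA₁ hsol
  have hd : ((F.P K).d : ℝ) = 3 := by norm_num [show (F.P K).d = 3 from rfl]
  have h𝔄' : ‖𝔄‖ < 2 * ((((F.P K).d : ℕ) : ℝ) * (F.L : ℝ)) * B₀ * C₁ * ε₁ := by rw [hd]; exact h𝔄
  have hU := isUnitaryBg_T3 e U₀
  have h14 := inU2cur_of_regPr e he U₀ hreg
  -- Prop. 6 at the objects: THE solution and its uniqueness in the ball
  obtain ⟨A, hA, hAsol, -, huniq⟩ := exists_solution_concrete _ h𝒢 hW hB₀ hC₄ hC₁ hB₃ hε₁ (three_L_cast hdLB₃) h1 h2 h3 hU h14 h𝔄'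
  have hEq : A₁ = A := huniq A₁ hA₁ hsol
  -- the contraction regime (118)∕(121) and the current bound (28)
  have hdL : (0 : ℝ) ≤ (((F.P K).d : ℕ) : ℝ) * (F.L : ℝ) := by positivity
  have hε₄ : 0 ≤ ε₄ := le_trans (by positivity) h1
  have R := Regime.ofProp6 (𝒢 := 𝒢) (W := W) h𝒢 hW hB₀.le hC₄.le hdL hC₁.le hε₁.le hε₄ (three_L_cast hdLB₃) h1 h2 h3
  have hJ := norm_Jcur_le (L := (F.L : ℝ)) (η := ((F.L : ℝ)⁻¹) ^ (K - n)) (lev₀ := fun _ : Bond (F.P K).d Pd => K - n) _ hU (by positivity) h14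
  have hfix : mapT 𝒢 0 W (Jcur fun b : Bond (F.P K).d Pd => unitsField (toUField U₀) ⟨e.symm b.1, b.2⟩) 𝔄 A = A :=
    (eq111_iff_fixed 𝒢 W _ 𝔄 A).1 hAsol
  have hmem : A ∈ (S : Set _) :=
    solution_mem_of_invariant R.norm_G R.norm_L R.quad R.B₀_nonneg R.C₄_nonneg R.θ_nonneg hJ h𝔄' R.ε₄_nonneg R.dom R.self R.contr
      (S : Set _) hS S.zero_mem (fun X hX hXn => by
        rw [mapT_apply, zero_apply, add_zero]
        exact S.sub_mem (S.neg_mem (h𝒢T _ hJT)) (h𝒢T _ (hWT X hX hXn))) hA.le hfix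
  rw [hEq]
  exact hmem

end Summit.QuantumFields.YangMills.Theorems.Prop7Prop6RealSolution

end
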